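import Summits.BirchSwinnertonDyer.BirchSwinnertonDyer.Theorems.AdditiveBranchIMCTwistFieldBaseChangeRat
import Summits.BirchSwinnertonDyer.Rank1Residual.Additive.GordThreeDelbourgo2002Bridge
import HarnessLib

/-!
# Crux `GordTwoRankZeroOffCaseOne` (route `AdditiveBranchIMC`, item 19357), lane k1-c2x gen 2: the
# twist-field road in DESCENDED shape — Part 5: the `p = 3` rows (the cell's largest block) — the b2b
# rational currency `ChiBranchRatLowerDvdOddAt W 3` from (BC-Gord, odd) with torsion by Delbourgo 2002
# at `3`, and the X3♯/X4♯(G-ord)@3 ends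

Sequel of `…TwistFieldBaseChangeRat` (Part 4). Cell `bsd-addord`, seat `bsd-addord-k1-c2x`.
Route-independent. HONEST FRAMING: theorems only; every published input is a DISPLAYED named-fact binder
(Kato 2004 Thm. 17.4 `kato_divisibility`, clauses (1)(2) only — NO image hypothesis in §10; Rohrlich 1984
`padicLFunction_ne_zero`; Delbourgo 2002 Thm. (A)(B) AT `p = 3` `Delbourgo2002.mainTheorem_three` — its
Hypothesis (semistable over a quadratic extension of `ℚ₃`) discharged in the kernel on the (G)-ordinary
locus by additive-p2's bridge `TypeGOrd.isTorsion_three_of_delbourgo2002`; for the ends Wuthrich 2014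
Thm. 16 / Kato's half-eigenspace reading, GZK, modularity); boundedness of the Néron-normalised minus
branch series is displayed (`MemIwasawaRat`); `GordTwistBaseChangeLowerOddAt W 3` (this lane) and
`ChiBranchRatLowerDvdOddAt W 3` (b2b n1011-p06) are typed CONJECTURES — nothing asserted; the unit
coefficient is a displayed per-pair CERTIFICATE (the b2b Q6 register holds such records); nothing is
booked; no label changes; BSD is not proved by any of this.

* §10 **`chiBranchRatLowerDvdOddAt_three_of_baseChangeOdd_of_delbourgo`** — on the (G)-ordinary
  additive locus at `3` (`Addv W 3 ∧ TypeGOrd W 3`), non-CM: (BC-Gord, odd) + Kato (1)(2) + Rohrlich +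
  boundedness ⟹ `ChiBranchRatLowerDvdOddAt W 3`, torsion of `X(W/ℚ_∞)` by Delbourgo 2002 (A) at `3`.
* §11 ENDS at `3` through n1011-p06: `ClassX3Gord.missingLowerBoundAt_three_rankZero_of_baseChangeOdd_of_unitCoeff`
  (REDUCIBLE `E[3]` — the crux's off-Case-1 reducible rows at `3` — NO image hypothesis) and
  `ClassX4Gord.missingLowerBoundAt_three_rankZero_of_baseChangeOdd_of_unitCoeff_of_surj`: the lower half
  `ord₃ #Ш_an ≤ ord₃ #Ш` ⟸ (BC-Gord, odd) (OPEN) + ONE unit coefficient + the named facts.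

References: D. Delbourgo, J. Number Theory 95 (2002) Thm. (A)(B) (p. 40), Hypothesis (p. 39)
[Delbourgo2002]; Skinner–Urban, Invent. Math. 195 (2014) Cor. 3.6.2 (p. 42) [SkinnerUrban2014]; K. Kato,
Astérisque 295 (2004) Thm. 17.4 [Kato2004Asterisque]; D. Rohrlich, Invent. Math. 75 (1984)
[RohrlichInventiones1984]; C. Wuthrich, J. London Math. Soc. 90 (2014) Thm. 16 [Wuthrich2014];
Mazur–Tate–Teitelbaum, Invent. Math. 84 (1986) §I.12–I.14 [MazurTateTeitelbaum1986Invent].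
-/

set_option autoImplicit false
set_option linter.dupNamespace false

noncomputable section

open scoped Classical MatrixGroups ModularForm

open CongruenceSubgroup WeierstrassCurve Literature.NumberTheory.EllipticCurves
  Literature.NumberTheory.EllipticCurves.ModularForms
  Literature.NumberTheory.EllipticCurves.Rank1Residual
  Literature.NumberTheory.EllipticCurves.Rank1Residual.Typed
  Literature.NumberTheory.GaloisRepresentations

namespace Summit.BirchSwinnertonDyer.BirchSwinnertonDyer.Theorems.AdditiveBranchIMCTwistField

open Summit.BirchSwinnertonDyer.Rank1Residual.Additive

/-! ## §10 `p = 3`: the rational currency from (BC-Gord, odd), torsion by Delbourgo 2002 at `3` -/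

section Three

variable {W : WeierstrassCurve ℚ} [W.IsElliptic] [W.IsGloballyMinimal] [hp : Fact (Nat.Prime 3)]

/-- **`ChiBranchRatLowerDvdOddAt W 3` from (BC-Gord, odd) on the (G)-ordinary additive locus at `3`,
non-CM** — torsion of `X(W/ℚ_∞)` by Delbourgo 2002 Thm. (A) at `p = 3`
(`Delbourgo2002.mainTheorem_three`, Hypothesis discharged by `TypeGOrd.isTorsion_three_of_delbourgo2002`);
Kato (1)(2) rational, Rohrlich, boundedness displayed; NO image hypothesis, NO certificate.
[cite: Delbourgo2002, Theorem (A) (p. 40), Hypothesis (p. 39)]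
[cite: Kato2004Asterisque, Thm. 17.4 (1)(2) (p. 273)] [cite: RohrlichInventiones1984, Theorem (p. 409)] -/
theorem chiBranchRatLowerDvdOddAt_three_of_baseChangeOdd_of_delbourgo
    (hkato : ∀ (V : WeierstrassCurve ℚ) [V.IsElliptic] [V.IsGloballyMinimal] (κ : ZpExtension ℚ 3)
      (γ : Field.absoluteGaloisGroup ℚ) (N : ℕ) [NeZero N] (f : CuspForm (Gamma0 N) 2),
      kato_divisibility V 3 (κ := κ) (γ := γ) (f := f))
    (hR : ∀ (V : WeierstrassCurve ℚ) [V.IsElliptic] [V.IsGloballyMinimal] (N : ℕ) [NeZero N]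
      (f : CuspForm (Gamma0 N) 2), padicLFunction_ne_zero (W := V) (p := 3) (f := f))
    (hbdd : ∀ (V : WeierstrassCurve ℚ) [V.IsElliptic] [V.IsGloballyMinimal] {N : ℕ} [NeZero N]
      (f : CuspForm (Gamma0 N) 2) (ϖ : ℚ),
      (∃ C : VariableChange ℚ, C • V.quadraticTwist (-(3 : ℚ)) = W) →
      GoodOrd V 3 → IsNewformOf V f → (ϖ : ℝ) * V.imaginaryPeriodRat = minusPeriod f →
      MemIwasawaRat 3
        (PowerSeries.C ((ϖ : ℚ) : ℚ_[3]) * padicLFunctionMinusBranch f (unitRoot V 3 : ℚ_[3]) (3 / 2)))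
    (hDel3 : Delbourgo2002.mainTheorem_three) (hcm : ¬ W.HasCM) (hadd : Addv W 3) (hG : TypeGOrd W 3)
    (hBC : GordTwistBaseChangeLowerOddAt W 3) :
    ChiBranchRatLowerDvdOddAt W 3 :=
  chiBranchRatLowerDvdOddAt_of_baseChangeOdd (p := 3) hkato hR
    (fun _ _ D hκ hγ ↦ hG.isTorsion_three_of_delbourgo2002 hDel3 hadd hcm hκ hγ D)
    (by exact_mod_cast hbdd) hBC

end Three

/-! ## §11 ENDS at `3` by name, through n1011-p06 -/

section ThreeEnds

variable {W : WeierstrassCurve ℚ} [W.IsElliptic] [W.IsGloballyMinimal] [hp : Fact (Nat.Prime 3)]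

/-- **X3♯(G-ord) at `3` (REDUCIBLE `E[3]` — the crux's off-Case-1 reducible rows at `3`), `r_an = 0`,
non-CM, non-anomalous: the LOWER half `ord₃ #Ш_an ≤ ord₃ #Ш` ⟸ the descended base-change input
`GordTwistBaseChangeLowerOddAt W 3` (OPEN) + ONE unit coefficient**, NO image hypothesis anywhere
(Wuthrich Thm. 16 `hWu`, Delbourgo 2002 at `3`, GZK, modularity, Kato (1)(2), Rohrlich, boundedness).
§10 ∘ n1011-p06's `ClassX3Gord.missingLowerBoundAt_three_rankZero_of_ratLowerDvdOdd_of_unitCoeff`.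
Nothing booked. [cite: Wuthrich2014, Thm. 16 (p. 397)] [cite: Delbourgo2002, Theorem (A), (B) (p. 40)]
[cite: Kato2004Asterisque, Thm. 17.4 (1)(2) (p. 273)] [cite: Miller2011LMS, Def. 1.1] -/
theorem ClassX3Gord.missingLowerBoundAt_three_rankZero_of_baseChangeOdd_of_unitCoeff
    (hWu : Wuthrich2014.thm16_halfEigenCharIdeal_dvd_cyclotomicPrime)
    (hDel3 : Delbourgo2002.mainTheorem_three)
    (hGZK : rank_eq_analyticRank_of_analyticRank_le_one) (hmod : hasEntireLFunction_rat)
    (hmodD : nonempty_modularParametrizationData)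
    (hkato : ∀ (V : WeierstrassCurve ℚ) [V.IsElliptic] [V.IsGloballyMinimal] (κ : ZpExtension ℚ 3)
      (γ : Field.absoluteGaloisGroup ℚ) (N : ℕ) [NeZero N] (f : CuspForm (Gamma0 N) 2),
      kato_divisibility V 3 (κ := κ) (γ := γ) (f := f))
    (hR : ∀ (V : WeierstrassCurve ℚ) [V.IsElliptic] [V.IsGloballyMinimal] (N : ℕ) [NeZero N]
      (f : CuspForm (Gamma0 N) 2), padicLFunction_ne_zero (W := V) (p := 3) (f := f))
    (hbdd : ∀ (V : WeierstrassCurve ℚ) [V.IsElliptic] [V.IsGloballyMinimal] {N : ℕ} [NeZero N]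
      (f : CuspForm (Gamma0 N) 2) (ϖ : ℚ),
      (∃ C : VariableChange ℚ, C • V.quadraticTwist (-(3 : ℚ)) = W) →
      GoodOrd V 3 → IsNewformOf V f → (ϖ : ℝ) * V.imaginaryPeriodRat = minusPeriod f →
      MemIwasawaRat 3
        (PowerSeries.C ((ϖ : ℚ) : ℚ_[3]) * padicLFunctionMinusBranch f (unitRoot V 3 : ℚ_[3]) (3 / 2)))
    (hX : ClassX3Gord W 3) (hcm : ¬ W.HasCM) (hr : W.analyticRank = 0)
    (hna : Delbourgo2002.ReductionNonAnomalous W 3) (hBC : GordTwistBaseChangeLowerOddAt W 3)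
    (hcert : ∀ (V : WeierstrassCurve ℚ) [V.IsElliptic] [V.IsGloballyMinimal] (C : VariableChange ℚ),
      GoodOrd V 3 → C • V.quadraticTwist (-(3 : ℚ)) = W →
      ∀ {N : ℕ} [NeZero N] (f : CuspForm (Gamma0 N) 2), IsNewformOf V f →
      ∀ ϖ : ℚ, (ϖ : ℝ) * V.imaginaryPeriodRat = minusPeriod f →
      ∃ n : ℕ, ‖PowerSeries.coeff n
        (PowerSeries.C (ϖ : ℚ_[3]) * padicLFunctionMinusBranch f (unitRoot V 3 : ℚ_[3]) (3 / 2))‖ = 1) :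
    MissingLowerBoundAt W 3 :=
  hX.missingLowerBoundAt_three_rankZero_of_ratLowerDvdOdd_of_unitCoeff hWu hDel3 hGZK hmod hmodD hcm hr hna
    (chiBranchRatLowerDvdOddAt_three_of_baseChangeOdd_of_delbourgo hkato hR hbdd hDel3 hcm hX.addv
      hX.typeGOrd hBC) hcert

/-- **X4♯(G-ord) at `3` ∧ surj(3), `r_an = 0`, non-CM, non-anomalous: the LOWER half ⟸
`GordTwistBaseChangeLowerOddAt W 3` (OPEN) + ONE unit coefficient** (+ Kato's half-eigenspace reading
`hKW`, Delbourgo 2002 at `3`, GZK, modularity, Kato (1)(2), Rohrlich, boundedness). §10 ∘ n1011-p06's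
`ClassX4Gord.missingLowerBoundAt_three_rankZero_of_ratLowerDvdOdd_of_unitCoeff_of_surj`. Nothing booked.
[cite: Kato2004Asterisque, Thm. 17.4 (p. 273)] [cite: Delbourgo2002, Theorem (A), (B) (p. 40)]
[cite: Miller2011LMS, Def. 1.1] -/
theorem ClassX4Gord.missingLowerBoundAt_three_rankZero_of_baseChangeOdd_of_unitCoeff_of_surj
    (hKW : Wuthrich2014.kato_halfEigenCharIdeal_dvd_cyclotomicPrime_of_surjective)
    (hDel3 : Delbourgo2002.mainTheorem_three)
    (hGZK : rank_eq_analyticRank_of_analyticRank_le_one) (hmod : hasEntireLFunction_rat)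
    (hmodD : nonempty_modularParametrizationData)
    (hkato : ∀ (V : WeierstrassCurve ℚ) [V.IsElliptic] [V.IsGloballyMinimal] (κ : ZpExtension ℚ 3)
      (γ : Field.absoluteGaloisGroup ℚ) (N : ℕ) [NeZero N] (f : CuspForm (Gamma0 N) 2),
      kato_divisibility V 3 (κ := κ) (γ := γ) (f := f))
    (hR : ∀ (V : WeierstrassCurve ℚ) [V.IsElliptic] [V.IsGloballyMinimal] (N : ℕ) [NeZero N]
      (f : CuspForm (Gamma0 N) 2), padicLFunction_ne_zero (W := V) (p := 3) (f := f))
    (hbdd : ∀ (V : WeierstrassCurve ℚ) [V.IsElliptic] [V.IsGloballyMinimal] {N : ℕ} [NeZero N]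
      (f : CuspForm (Gamma0 N) 2) (ϖ : ℚ),
      (∃ C : VariableChange ℚ, C • V.quadraticTwist (-(3 : ℚ)) = W) →
      GoodOrd V 3 → IsNewformOf V f → (ϖ : ℝ) * V.imaginaryPeriodRat = minusPeriod f →
      MemIwasawaRat 3
        (PowerSeries.C ((ϖ : ℚ) : ℚ_[3]) * padicLFunctionMinusBranch f (unitRoot V 3 : ℚ_[3]) (3 / 2)))
    (hX : ClassX4Gord W 3) (hcm : ¬ W.HasCM) (hr : W.analyticRank = 0) (hsurj : Surj W 3)
    (hna : Delbourgo2002.ReductionNonAnomalous W 3) (hBC : GordTwistBaseChangeLowerOddAt W 3)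
    (hcert : ∀ (V : WeierstrassCurve ℚ) [V.IsElliptic] [V.IsGloballyMinimal] (C : VariableChange ℚ),
      GoodOrd V 3 → C • V.quadraticTwist (-(3 : ℚ)) = W →
      ∀ {N : ℕ} [NeZero N] (f : CuspForm (Gamma0 N) 2), IsNewformOf V f →
      ∀ ϖ : ℚ, (ϖ : ℝ) * V.imaginaryPeriodRat = minusPeriod f →
      ∃ n : ℕ, ‖PowerSeries.coeff n
        (PowerSeries.C (ϖ : ℚ_[3]) * padicLFunctionMinusBranch f (unitRoot V 3 : ℚ_[3]) (3 / 2))‖ = 1) :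
    MissingLowerBoundAt W 3 :=
  hX.missingLowerBoundAt_three_rankZero_of_ratLowerDvdOdd_of_unitCoeff_of_surj hKW hDel3 hGZK hmod hmodD hcm
    hr hsurj hna (chiBranchRatLowerDvdOddAt_three_of_baseChangeOdd_of_delbourgo hkato hR hbdd hDel3 hcm
      hX.addv.2 hX.typeGOrd hBC) hcert

end ThreeEnds

end Summit.BirchSwinnertonDyer.BirchSwinnertonDyer.Theorems.AdditiveBranchIMCTwistField

end
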